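import Summits.NavierStokesRegularity.FluidComputer.ClayBlowupZoomTypeI
import Literature.Analysis.FluidPDE.AncientL3BackwardLiouvilleHolds
import Literature.Analysis.FluidPDE.NSSereginEnergyApproximants
import HarnessLib

/-!
# ESS WITH THE CLAY FORCE: `limsup_{t↑T} ‖u(t)‖_{L³} = ∞` for EVERY Clay blow-up, with its Clay
# force — the zoom with force lands in Albritton–Barker's backward-`L³` Liouville theorem

Cell `ns-blowup`, seat `ns-blowup-ecbridge-2` (g10; the E–C endpoint theory seat). LABEL: E–C typing
(KERNEL — no named fact). WHAT THIS IS NOT: not Navier–Stokes evidence — a necessary condition on the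
TYPE `ClayBlowup ν` (no inhabitant is claimed anywhere). Companion memo:
`run/shared/lean/pub/ns-blowup/ecbridge2/ECBRIDGE-2-MEMO-9.md`.

## Content

MEMO-7/8 carried the K3 row (Escauriaza–Seregin–Šverák 2003, Thm 1.3: the critical norm `‖u(t)‖_{L³}`
is unbounded at a blow-up time) as KERNEL only for the UNFORCED type (g7
`ClayBlowup.limsup_eLpNorm_three_eq_top (hf : X.f = 0)`, through Leray–Hopf completion and the
tree's ESS discharge) and «F open, XL: needs forced ESS local regularity». THE ZOOM WITH FORCE closes
it WITHOUT any forced regularity theory: if `‖u(t)‖_{L³} ≤ A` on a final interval `[t₁, T)`, the zoom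
slices `c_k u(t_k + c_k² s, x_k + c_k ·)` have the SAME `L³` norm (scale invariance in dimension 3),
so by Fatou every slice of the zoom limit `W` has `‖W(s)‖_{L³} ≤ A`; `W` is a bounded ancient UNFORCED
Oseen-mild solution (`exists_zoom_limit`), hence ZERO by the tree's discharge of Albritton–Barker
2019, Thm 1.2 (`AlbrittonBarker2019_liouville_L3_backward_holds`: ancient mild solutions bounded in
`L³` along a backward sequence vanish — the ESS backward-uniqueness machinery, unforced), against
`‖W(0,0)‖ = 1` and the continuity of `W` at the vertex.

* `eLpNorm_three_zoom` — `‖(c • stPull (c²) c t₀ x₀ u)(s)‖_{L³} = ‖u(t₀ + c²s)‖_{L³}`;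
* `ClayBlowup.not_eLpNorm_three_bounded_near_one` (`ν = 1` core);
* **`ClayBlowup.limsup_eLpNorm_three_eq_top_forced`** — for EVERY `X : ClayBlowup ν`, `ν > 0`, ANY
  Clay force, every `M` and every `t₀ < T` there is `t ∈ (t₀, T)`, `t ≥ 0`, with `‖u(t)‖_{L³} > M`
  (g7's shape, `hf` removed); `DesignedBlowup` / `Realisation` twins; (C)-reading.

References: L. Escauriaza, G. Seregin, V. Šverák, Russ. Math. Surveys 58 (2003), Thm 1.3
[cite: EscauriazaSereginSverak2003, Thm. 1.3]; D. Albritton, T. Barker, J. Math. Fluid Mech. 21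
(2019), Thm 1.2 [cite: AlbrittonBarker2019, Thm 1.2]; Koch–Nadirashvili–Seregin–Šverák, Acta
Math. 203 (2009), Prop 6.1 [cite: KochNadirashviliSereginSverak2009, Prop 6.1]; C. L. Fefferman, (C)
[cite: FeffermanClay2006, (C)].
-/

noncomputable section

namespace Summit.NavierStokesRegularity.FluidComputer

open Set MeasureTheory Filter Topology Function Metric
open scoped ENNReal NNReal
open Literature.Analysis Literature.Analysis.FluidPDE
open Summit.NavierStokesRegularity.NavierStokesRegularity

/-! ## §1 The `L³` norm is invariant under the zoom -/

/-- **`L³` scale invariance of the zoom slices**: `‖c u(t', x₀ + c ·)‖_{L³(ℝ³)} = ‖u(t')‖_{L³}`,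
`t' = t₀ + c²s` (`c > 0`; Jacobian `c⁻³` against `c³`). [cite: EscauriazaSereginSverak2003, §3 (scale invariance of L_{3,∞})] -/
theorem eLpNorm_three_zoom {c : ℝ} (hc : 0 < c) (t₀ : ℝ) (x₀ : EuclideanSpace ℝ (Fin 3))
    (u : ℝ → EuclideanSpace ℝ (Fin 3) → EuclideanSpace ℝ (Fin 3)) (s : ℝ) :
    eLpNorm ((c • stPull (c ^ 2) c t₀ x₀ u) s) 3 volume = eLpNorm (u (t₀ + c ^ 2 * s)) 3 volume := by
  have e : (c • stPull (c ^ 2) c t₀ x₀ u) s = fun y => (c / 1) • u (t₀ + c ^ 2 * s) (x₀ + c • y) := by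
    funext y; rw [smul_stPull_apply, div_one]
  rw [e, eLpNorm_three_smul_comp_affine _ one_pos hc x₀, inv_one, ENNReal.ofReal_one, one_mul]

namespace ClayBlowup

/-! ## §2 The core at viscosity `1` -/

/-- **`‖u(t)‖_{L³}` IS NOT BOUNDED ON ANY FINAL INTERVAL of a Clay blow-up at viscosity `1`, WITH its
Clay force** (no named fact): the zoom limit would be an `L³`-bounded bounded ancient mild solution
of the UNFORCED equations, which vanishes (`AlbrittonBarker2019_liouville_L3_backward_holds`), against
`‖W(0,0)‖ = 1`. [cite: EscauriazaSereginSverak2003, Thm. 1.3] [cite: AlbrittonBarker2019, Thm 1.2] -/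
theorem not_eLpNorm_three_bounded_near_one (Y : ClayBlowup 1) :
    ¬ ∃ A : ℝ≥0∞, A < ⊤ ∧ ∃ t₁ < Y.T, ∀ t ∈ Ico t₁ Y.T, eLpNorm (Y.u t) 3 volume ≤ A := by
  rintro ⟨A, hA, t₁, ht₁, hbd⟩
  have hT := Y.T_pos
  obtain ⟨t, x, c, φ, W, δ, hφ, hδ, ht, hc, hc01, hk1, -, -, hWc, hWdiv, hWmild, -, hW1, hW0, -, -,
    hconv⟩ := Y.exists_zoom_limit
  have hc0 : ∀ k, 0 < c k := fun k => (hc01 k).1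
  -- ### the limit on `(−∞, 0)`
  have hpt : ∀ s < 0, ∀ y, Tendsto
      (fun j => (c (φ j) • stPull (c (φ j) ^ 2) (c (φ j)) (t (φ j)) (x (φ j)) Y.u) s y) atTop
      (𝓝 (W s y)) := fun s hs y =>
    ((hconv s (hs.trans hδ)).tendstoLocallyUniformlyOn (s := univ)).tendsto_at (mem_univ y)
  have hWc0 : ContinuousOn (uncurry W) (Iio 0 ×ˢ univ) :=
    hWc.mono (prod_mono (fun s hs => lt_trans hs hδ) subset_rfl)
  have hWdiv0 : ∀ s < 0, IsWeaklyDivFree (W s) := fun s hs => hWdiv s (hs.trans hδ)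
  have hWmild0 : ∀ s τ : ℝ, s < τ → τ < 0 → ∀ y,
      W τ y = UnboundedOperators.heatExtension (W s) (τ - s) y - oseenDuhamel 1 s W W τ y :=
    fun s τ hsτ hτ y => hWmild s τ hsτ (hτ.trans hδ) y
  have hWbd0 : ∀ s < 0, ∀ y, ‖W s y‖ ≤ 1 := fun s hs y => hW1 s hs.le y
  -- ### the slice times `t_{φ j} + c_{φ j}² s` lie in `[t₁, T)` eventually
  have htT : Tendsto t atTop (𝓝[<] Y.T) := Y.tendsto_of_norm_ge one_pos ht hk1
  have hcto : Tendsto c atTop (𝓝 0) := by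
    have hMto : Tendsto (fun k => ‖Y.u (t k) (x k)‖) atTop atTop := by
      refine tendsto_atTop_atTop.2 fun B => ⟨⌈B⌉₊, fun k hk => ?_⟩
      have h1 : (⌈B⌉₊ : ℝ) ≤ k := by exact_mod_cast hk
      linarith [Nat.le_ceil B, hk1 k]
    exact (tendsto_inv_atTop_zero.comp hMto).congr fun k => by simp [Function.comp, hc k]
  have hvalid : ∀ s ≤ 0, ∀ᶠ j in atTop, t (φ j) + c (φ j) ^ 2 * s ∈ Ico (max t₁ 0) Y.T := by
    intro s hs
    have h1 : Tendsto (fun j => t (φ j)) atTop (𝓝 Y.T) :=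
      (tendsto_nhdsWithin_iff.1 htT).1.comp hφ.tendsto_atTop
    have h2 : Tendsto (fun j => c (φ j) ^ 2 * s) atTop (𝓝 0) := by
      simpa using ((hcto.comp hφ.tendsto_atTop).pow 2).mul_const s
    have h3 : Tendsto (fun j => t (φ j) + c (φ j) ^ 2 * s) atTop (𝓝 Y.T) := by simpa using h1.add h2
    filter_upwards [h3.eventually (Ioi_mem_nhds (max_lt ht₁ hT))] with j hj
    have : c (φ j) ^ 2 * s ≤ 0 := mul_nonpos_of_nonneg_of_nonpos (sq_nonneg _) hs
    exact ⟨le_of_lt hj, lt_of_le_of_lt (by linarith) (ht (φ j)).2⟩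
  -- ### Fatou: every slice of the limit has `‖W(s)‖_{L³} ≤ A`
  have hL3 : ∀ s < 0, eLpNorm (W s) 3 volume ≤ A := by
    intro s hs
    obtain ⟨J, hJ⟩ := eventually_atTop.1 (hvalid s hs.le)
    -- the shifted sequence of zoom slices, all valid
    set f : ℕ → EuclideanSpace ℝ (Fin 3) → EuclideanSpace ℝ (Fin 3) := fun n =>
      (c (φ (n + J)) • stPull (c (φ (n + J)) ^ 2) (c (φ (n + J))) (t (φ (n + J))) (x (φ (n + J)))
        Y.u) s with hf
    have hfm : ∀ n, AEStronglyMeasurable (f n) volume := by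
      intro n
      have hv := hJ (n + J) (Nat.le_add_left J n)
      have hcd := Y.classical.contDiff_velocity ⟨(le_max_right _ _).trans hv.1, hv.2⟩
      have e : f n = fun y => c (φ (n + J)) •
          Y.u (t (φ (n + J)) + c (φ (n + J)) ^ 2 * s) (x (φ (n + J)) + c (φ (n + J)) • y) := rfl
      rw [e]
      have haff : Continuous (fun y : EuclideanSpace ℝ (Fin 3) => x (φ (n + J)) + c (φ (n + J)) • y) :=
        continuous_const.add (continuous_id.const_smul (c (φ (n + J))))
      exact ((hcd.continuous.comp haff).const_smul (c (φ (n + J)))).aestronglyMeasurable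
    have hflim : ∀ y, Tendsto (fun n => f n y) atTop (𝓝 (W s y)) := fun y =>
      (hpt s hs y).comp (tendsto_add_atTop_nat J)
    have hfat := MeasureTheory.Lp.eLpNorm_lim_le_liminf_eLpNorm (p := (3 : ℝ≥0∞)) hfm (W s)
      (Eventually.of_forall hflim)
    refine hfat.trans (Filter.liminf_le_of_frequently_le' (Eventually.of_forall fun n => ?_).frequently)
    rw [hf, eLpNorm_three_zoom (hc0 _)]
    have hv := hJ (n + J) (Nat.le_add_left J n)
    exact hbd _ ⟨(le_max_left _ _).trans hv.1, hv.2⟩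
  -- ### Albritton–Barker: the limit vanishes on `(−∞, 0)`
  have hzero : ∀ s < 0, ∀ y, W s y = 0 := by
    refine AlbrittonBarker2019_liouville_L3_backward_holds hWc0 ⟨1, hWbd0⟩ hWdiv0 hWmild0
      ⟨fun k => -((k : ℝ) + 1), A, hA, ?_, fun k => by linarith [k.cast_nonneg (α := ℝ)],
        fun k => hL3 _ (by linarith [k.cast_nonneg (α := ℝ)])⟩
    exact tendsto_neg_atTop_atBot.comp
      (tendsto_atTop_add_const_right _ _ tendsto_natCast_atTop_atTop)
  -- ### the vertex: `W(0,0) = 0` by continuity, against `‖W(0,0)‖ = 1`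
  have hcat : ContinuousAt (uncurry W) (0, 0) :=
    hWc.continuousAt ((isOpen_Iio.prod isOpen_univ).mem_nhds ⟨hδ, mem_univ _⟩)
  have hpath : Tendsto (fun s : ℝ => ((s, (0 : EuclideanSpace ℝ (Fin 3))) : ℝ × _)) (𝓝[<] 0)
      (𝓝 (0, 0)) :=
    ((Continuous.prodMk_left 0).tendsto 0).mono_left nhdsWithin_le_nhds
  have hlim0 : Tendsto (fun s : ℝ => W s 0) (𝓝[<] 0) (𝓝 (W 0 0)) := hcat.tendsto.comp hpath
  have hconst : Tendsto (fun s : ℝ => W s 0) (𝓝[<] 0) (𝓝 0) :=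
    tendsto_const_nhds.congr' (eventually_nhdsWithin_of_forall fun s hs => (hzero s hs 0).symm)
  have h00 : W 0 0 = 0 := tendsto_nhds_unique hlim0 hconst
  rw [h00, norm_zero] at hW0
  exact zero_ne_one hW0

/-! ## §3 Every viscosity: the ESS row with the Clay force -/

/-- **ESS WITH THE CLAY FORCE** (`ν > 0`, ANY Clay force; no named fact): for every Clay blow-up,
every `M ≥ 0` and every `t₀ < T`, some `t ∈ (t₀, T)`, `t ≥ 0`, has `‖u(t)‖_{L³} > M` —
`limsup_{t↑T} ‖u(t)‖_{L³(ℝ³)} = ∞` (Escauriaza–Seregin–Šverák 2003, Thm 1.3, WITH the force).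
Supersedes g7's `limsup_eLpNorm_three_eq_top (hf : X.f = 0)`. The viscosity normalisation
`rescale` multiplies `L³` norms by the constant `1/ν`. [cite: EscauriazaSereginSverak2003, Thm. 1.3]
[cite: AlbrittonBarker2019, Thm 1.2] -/
theorem limsup_eLpNorm_three_eq_top_forced {ν : ℝ} (X : ClayBlowup ν) (hν : 0 < ν) (M : ℝ≥0)
    {t₀ : ℝ} (ht₀ : t₀ < X.T) :
    ∃ t ∈ Ioo t₀ X.T, 0 ≤ t ∧ (M : ℝ≥0∞) < eLpNorm (X.u t) 3 volume := by
  by_contra hcon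
  push Not at hcon
  -- `‖u(t)‖₃ ≤ M` on `[max t₀' 0, T)`; transport to the normalised blow-up
  set a : ℝ := 1 / ν with ha
  have ha0 : 0 < a := by positivity
  set Y : ClayBlowup 1 := X.rescale hν one_pos with hY
  have hYT : Y.T = X.T / a := X.rescale_T hν one_pos
  set t₁ : ℝ := max t₀ 0 / a + (X.T / a - max t₀ 0 / a) / 2 with ht₁
  have hm : max t₀ 0 < X.T := max_lt ht₀ X.T_pos
  have ht₁T : t₁ < Y.T := by
    rw [hYT, ht₁]
    have : max t₀ 0 / a < X.T / a := div_lt_div_of_pos_right hm ha0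
    linarith
  have ht₁0 : max t₀ 0 / a < t₁ := by
    rw [ht₁]
    have : max t₀ 0 / a < X.T / a := div_lt_div_of_pos_right hm ha0
    linarith
  refine Y.not_eLpNorm_three_bounded_near_one ⟨ENNReal.ofReal a * M, ENNReal.mul_lt_top
    ENNReal.ofReal_lt_top ENNReal.coe_lt_top, t₁, ht₁T, fun s hs => ?_⟩
  have hslice : Y.u s = a • X.u (a * s) := funext fun y => X.rescale_u_apply hν one_pos s y
  rw [hslice, eLpNorm_const_smul, Real.enorm_eq_ofReal ha0.le]
  refine mul_le_mul_right ?_ _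
  have has : a * s ∈ Ioo t₀ X.T ∧ 0 ≤ a * s := by
    have h1 : max t₀ 0 < a * s := by
      have := mul_lt_mul_of_pos_left (ht₁0.trans_le hs.1) ha0
      rwa [mul_div_cancel₀ _ ha0.ne'] at this
    have h2 : a * s < X.T := by
      have := mul_lt_mul_of_pos_left hs.2 ha0
      rwa [hYT, mul_div_cancel₀ _ ha0.ne'] at this
    exact ⟨⟨(le_max_left _ _).trans_lt h1, h2⟩, (le_max_right _ _).trans h1.le⟩
  exact hcon (a * s) has.1 has.2

end ClayBlowup

/-! ## §4 Twins and the (C)-reading -/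

/-- **ESS with the force, for designed blow-ups** (`ν > 0`). [cite: EscauriazaSereginSverak2003, Thm. 1.3] -/
theorem DesignedBlowup.limsup_eLpNorm_three_eq_top_forced {ν : ℝ} (D : DesignedBlowup ν) (hν : 0 < ν)
    (M : ℝ≥0) {t₀ : ℝ} (ht₀ : t₀ < D.T) :
    ∃ t ∈ Ioo t₀ D.T, 0 ≤ t ∧ (M : ℝ≥0∞) < eLpNorm (D.u t) 3 volume :=
  D.toClayBlowup.limsup_eLpNorm_three_eq_top_forced hν M ht₀

/-- **ESS with the force, on the tower interface** (`ν > 0`): every tower realisation has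
`‖u(t)‖_{L³}` unbounded as `t ↑ T`, WITH its forcing. [cite: EscauriazaSereginSverak2003, Thm. 1.3] -/
theorem PalasekTowerClayBridge.Realisation.limsup_eLpNorm_three_eq_top {ν : ℝ} {R : TowerRates}
    (W : PalasekTowerClayBridge.Realisation ν R) (hν : 0 < ν) (M : ℝ≥0) {t₀ : ℝ} (ht₀ : t₀ < W.T) :
    ∃ t ∈ Ioo t₀ W.T, 0 ≤ t ∧ (M : ℝ≥0∞) < eLpNorm (W.u t) 3 volume :=
  W.toDesignedBlowup.limsup_eLpNorm_three_eq_top_forced hν M ht₀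

/-- **(C)-READING OF ESS WITH FORCE**: if Fefferman's (C) holds then at every `ν > 0` there is a
Clay blow-up whose `L³` norm is unbounded near its lifespan. [cite: EscauriazaSereginSverak2003, Thm. 1.3]
[cite: FeffermanClay2006, (C)] -/
theorem breakdownR3_L3_forced
    (h : Summit.NavierStokesRegularity.NavierStokesRegularity.NavierStokesBreakdownR3) {ν : ℝ}
    (hν : 0 < ν) :
    ∃ X : ClayBlowup ν, ∀ M : ℝ≥0, ∀ t₀ < X.T,
      ∃ t ∈ Ioo t₀ X.T, 0 ≤ t ∧ (M : ℝ≥0∞) < eLpNorm (X.u t) 3 volume := by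
  obtain ⟨X⟩ := forall_nonempty_clayBlowup_of_breakdownR3 h ν hν
  exact ⟨X, fun M t₀ ht₀ => X.limsup_eLpNorm_three_eq_top_forced hν M ht₀⟩

end Summit.NavierStokesRegularity.FluidComputer

end
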